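import Summits.HubbardSuperconductivity.HubbardSuperconductivity.Theorems.AnisotropyChordTransferFibre3RateLemma

/-!
# Route `AnisotropyChord` / H0 rotor rung: PartN39 — the ZERO-ROW IDENTITY, PROVED

PORT PartN39 (`…Fibre3RateLemma`, theory seat `hubbard-h0-rotor-theory-1` g21, memo 21 §322) types
`RateLemma.ZeroRowIdentity L`: `(1/L) Σ_{k=1}^{L−1} (1 − cos(2πky/L))/(2 − 2cos(2πk/L)) = y(L − y)/(2L)` for `0 ≤ y ≤ L`
(the `p = 0` row of the torus potential kernel at `λ = 0`; the 1D periodic Green's function).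
This file proves it (`zeroRowIdentity_holds`) by the discrete Dirichlet problem: `g(y) := Σ_k (1 − cos(kθy))/(2 − 2cos kθ)`
has `g(0) = 0`, `g(1) = (L−1)/2` and second difference `g(y+1) − 2g(y) + g(y−1) = Σ_{k=1}^{L−1} cos(kθy) = −1` for
`0 < y < L` (vanishing of the character sum `Σ_{k=0}^{L−1} cos(2πky/L)`, via the `L`-th roots of unity), whence
`g(y) = y(L−y)/2` by two-step induction.
Prover seat `hubbard-h0-rotor-p2` g0; helper for stmt-HubbardSuperconductivity-19089 (`--supports`, helper class).
WHAT THIS IS NOT: nothing here proves superconductivity in the Hubbard model; helper identity of ONE conditional reduction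
(rung 19089, HOLE₂(.75) near-pair tail, periodisation at `λ = 0`).  Mathlib + tree imports only; no sorry, no axioms.
-/

set_option linter.dupNamespace false

noncomputable section

namespace Summit.HubbardSuperconductivity.HubbardSuperconductivity.Theorems.AnisotropyChord.Transfer.Fibre3

namespace RateLemma

open Real Finset

/-- the character sum `Σ_{k=0}^{L−1} cos(2πky/L)` vanishes for `0 < y < L`. -/
theorem sum_cos_mul_eq_zero (L y : ℕ) (hy0 : 0 < y) (hyL : y < L) :
    ∑ k ∈ Finset.range L, Real.cos (2 * Real.pi * k * y / L) = 0 := by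
  have hL0 : L ≠ 0 := by omega
  set ζ : ℂ := Complex.exp (2 * Real.pi * Complex.I / L) with hζ
  have hprim : IsPrimitiveRoot ζ L := Complex.isPrimitiveRoot_exp L hL0
  set ω : ℂ := ζ ^ y with hω
  have hωL : ω ^ L = 1 := by
    rw [hω, ← pow_mul, mul_comm, pow_mul, hprim.pow_eq_one, one_pow]
  have hω1 : ω ≠ 1 := by
    rw [hω]
    intro h
    have hdvd := (hprim.pow_eq_one_iff_dvd y).1 h
    exact absurd (Nat.le_of_dvd hy0 hdvd) (by omega)
  have hgeom : (∑ k ∈ Finset.range L, ω ^ k) * (ω - 1) = 0 := by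
    rw [geom_sum_mul, hωL, sub_self]
  have hsum : ∑ k ∈ Finset.range L, ω ^ k = 0 := by
    rcases mul_eq_zero.1 hgeom with h | h
    · exact h
    · exact absurd (sub_eq_zero.1 h) hω1
  have hre := congrArg Complex.re hsum
  rw [Complex.re_sum, Complex.zero_re] at hre
  have hterm : ∀ k : ℕ, (ω ^ k).re = Real.cos (2 * Real.pi * k * y / L) := by
    intro k
    rw [hω, hζ, ← pow_mul, ← Complex.exp_nat_mul, ← Complex.exp_ofReal_mul_I_re]
    congr 1
    push_cast
    ring
  simp only [hterm] at hre
  exact hre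

/-- no denominator vanishes: `cos(2πk/L) ≠ 1` for `0 < k < L`. -/
theorem cos_ne_one (L k : ℕ) (hk0 : 0 < k) (hkL : k < L) : Real.cos (2 * Real.pi * k / L) ≠ 1 := by
  have hL : (0 : ℝ) < L := by exact_mod_cast (show 0 < L by omega)
  have hk : (0 : ℝ) < k := by exact_mod_cast hk0
  have hkL' : (k : ℝ) < L := by exact_mod_cast hkL
  intro h
  rw [Real.cos_eq_one_iff_of_lt_of_lt] at h
  · have : (2 * Real.pi * k / L : ℝ) > 0 := by positivity
    linarith
  · have : (0 : ℝ) < 2 * Real.pi * k / L := by positivity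
    linarith [Real.pi_pos]
  · rw [div_lt_iff₀ hL]
    nlinarith [Real.pi_pos]

/-- the row sum as a function of the height `y`. -/
def zeroRow (L y : ℕ) : ℝ :=
  ∑ k ∈ (Finset.range L).erase 0, (1 - Real.cos (2 * Real.pi * k * y / L)) / (2 - 2 * Real.cos (2 * Real.pi * k / L))

/-- `g(0) = 0`. -/
theorem zeroRow_zero (L : ℕ) : zeroRow L 0 = 0 := by
  unfold zeroRow
  refine Finset.sum_eq_zero (fun k _ => ?_)
  simp

/-- `g(1) = (L − 1)/2`. -/
theorem zeroRow_one (L : ℕ) (hL : 1 ≤ L) : zeroRow L 1 = ((L : ℝ) - 1) / 2 := by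
  unfold zeroRow
  have hterm : ∀ k ∈ (Finset.range L).erase 0,
      (1 - Real.cos (2 * Real.pi * k * (1 : ℕ) / L)) / (2 - 2 * Real.cos (2 * Real.pi * k / L)) = 1 / 2 := by
    intro k hk
    rw [Finset.mem_erase, Finset.mem_range] at hk
    have hc := cos_ne_one L k (Nat.pos_of_ne_zero hk.1) hk.2
    have hden : 2 - 2 * Real.cos (2 * Real.pi * k / L) ≠ 0 := by
      intro h; apply hc; linarith
    rw [div_eq_div_iff hden two_ne_zero]
    push_cast
    ring
  rw [Finset.sum_congr rfl hterm, Finset.sum_const, Finset.card_erase_of_mem (by simp; omega),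
    Finset.card_range]
  rw [nsmul_eq_mul]
  push_cast [Nat.cast_sub hL]
  ring

/-- the second difference: `g(j+2) − 2g(j+1) + g(j) = −1` for `j + 2 ≤ L`. -/
theorem zeroRow_step (L j : ℕ) (hj : j + 2 ≤ L) :
    zeroRow L (j + 2) - 2 * zeroRow L (j + 1) + zeroRow L j = -1 := by
  unfold zeroRow
  rw [Finset.mul_sum, ← Finset.sum_sub_distrib, ← Finset.sum_add_distrib]
  have hterm : ∀ k ∈ (Finset.range L).erase 0,
      (1 - Real.cos (2 * Real.pi * k * (j + 2 : ℕ) / L)) / (2 - 2 * Real.cos (2 * Real.pi * k / L))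
        - 2 * ((1 - Real.cos (2 * Real.pi * k * (j + 1 : ℕ) / L)) / (2 - 2 * Real.cos (2 * Real.pi * k / L)))
        + (1 - Real.cos (2 * Real.pi * k * (j : ℕ) / L)) / (2 - 2 * Real.cos (2 * Real.pi * k / L))
        = Real.cos (2 * Real.pi * k * (j + 1 : ℕ) / L) := by
    intro k hk
    rw [Finset.mem_erase, Finset.mem_range] at hk
    have hc := cos_ne_one L k (Nat.pos_of_ne_zero hk.1) hk.2
    have hden : 2 - 2 * Real.cos (2 * Real.pi * k / L) ≠ 0 := by
      intro h; apply hc; linarith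
    set a : ℝ := 2 * Real.pi * k * (j + 1 : ℕ) / L with ha
    set b : ℝ := 2 * Real.pi * k / L with hb
    have e2 : 2 * Real.pi * k * (j + 2 : ℕ) / L = a + b := by rw [ha, hb]; push_cast; ring
    have e0 : 2 * Real.pi * k * (j : ℕ) / L = a - b := by rw [ha, hb]; push_cast; ring
    rw [e2, e0, Real.cos_add, Real.cos_sub]
    field_simp
    ring
  rw [Finset.sum_congr rfl hterm]
  -- Σ_{k=1}^{L-1} cos = (Σ_{k=0}^{L-1} cos) − 1 = −1
  have h0 : (0 : ℕ) ∈ Finset.range L := by simp; omega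
  have hfull := Finset.sum_erase_add (Finset.range L) (fun k : ℕ => Real.cos (2 * Real.pi * k * (j + 1 : ℕ) / L)) h0
  rw [sum_cos_mul_eq_zero L (j + 1) (by omega) (by omega)] at hfull
  simp only [Nat.cast_zero, mul_zero, zero_mul, zero_div, Real.cos_zero] at hfull
  linarith

/-- the closed form `g(y) = y(L − y)/2` for `y ≤ L`. -/
theorem zeroRow_eq (L : ℕ) (hL : 1 ≤ L) : ∀ y : ℕ, y ≤ L → zeroRow L y = (y : ℝ) * ((L : ℝ) - y) / 2 := by
  -- two-step induction: P j ∧ P (j+1)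
  have key : ∀ j : ℕ, j + 1 ≤ L →
      zeroRow L j = (j : ℝ) * ((L : ℝ) - j) / 2 ∧ zeroRow L (j + 1) = ((j + 1 : ℕ) : ℝ) * ((L : ℝ) - (j + 1 : ℕ)) / 2 := by
    intro j
    induction j with
    | zero =>
      intro _
      refine ⟨by rw [zeroRow_zero]; simp, ?_⟩
      rw [zeroRow_one L hL]; push_cast; ring
    | succ j ih =>
      intro hj
      obtain ⟨h1, h2⟩ := ih (by omega)
      refine ⟨h2, ?_⟩
      have hs := zeroRow_step L j (by omega)
      have : zeroRow L (j + 2) = 2 * zeroRow L (j + 1) - zeroRow L j - 1 := by linarith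
      rw [show j + 1 + 1 = j + 2 by ring, this, h1, h2]
      push_cast
      ring
  intro y hy
  rcases Nat.eq_zero_or_pos y with rfl | hpos
  · rw [zeroRow_zero]; simp
  · obtain ⟨j, rfl⟩ : ∃ j, y = j + 1 := ⟨y - 1, by omega⟩
    exact (key j hy).2

/-- ★ `ZeroRowIdentity` holds. -/
theorem zeroRowIdentity_holds (L : ℕ) [NeZero L] : ZeroRowIdentity L := by
  intro y hy
  have hL : 1 ≤ L := Nat.pos_of_ne_zero (NeZero.ne L)
  have hLr : (L : ℝ) ≠ 0 := by exact_mod_cast (NeZero.ne L)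
  have h := zeroRow_eq L hL y hy
  unfold zeroRow at h
  rw [h]
  field_simp

end RateLemma

end Summit.HubbardSuperconductivity.HubbardSuperconductivity.Theorems.AnisotropyChord.Transfer.Fibre3

end
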